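import Summits.ValiantsHypothesis.ValiantsHypothesis.Theorems.KPlusLogSqLawValuativeDoorTieFamily

/-!
# LINE `valuative_door` (crux `WeakLifting`, stmt-ValiantsHypothesis-19561) — the CHAIN OF DOMINANT SETS of an exchange system:
# the rank potential strictly increases with the slope, so at most `m (K − m) + 1` sets are ever dominant

HONEST FRAMING.  Helper (cell `pub-symmetroid`, seat val-sym-lift-p1 g22, 2026-08-29; `--supports 19561 --as helper`).  Abstract setting of
`…ValuativeDoorTieFamily` (family `𝒮` of `m`-sets with the valuated-matroid exchange axiom for log-weights `a`, distinct slopes `d`;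
NO dissociation: the exponent `E(S) = Σ_{l∈S} d l` need not be injective on `𝒮` — the top tie at any slope is unique anyway, `tieMax_unique`).  A set `S ∈ 𝒮` is DOMINANT at slope `s` if its line `a(S) + s·E(S)` strictly exceeds every
other line of `𝒮` (for the rank-one lacunary determinant: `E(S)` is a dominant exponent = a vertex of the Newton polygon).  THEOREM
(`rankPotential_lt_of_dominant`): if `I` is dominant at `s` and `J ≠ I` at `s' > s` then `Φ(I) < Φ(J)` for the rank potential `Φ` — proof by
the BREAKPOINT CHAIN: at the first slope `s* ∈ (s, s')` where a line of larger exponent catches `I`, the tie family contains `I` as its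
bottom and some `J₁ ≠ I` as its top, `Φ(I) < Φ(J₁)` by Gale domination (`rankPotential_lt_of_tieMax`), and `J₁` is dominant just after `s*`;
induction on the number of sets of exponent above `E(I)` (`exists_next_dominant`; sets of equal exponent keep a constant gap, and two top ties
coincide by `tieMax_unique`).  COUNT (`card_dominant_le`): `Φ` is then injective on the
dominant sets and is a sum of `m` distinct ranks, so at most `m (K − m) + 1` sets of `𝒮` are dominant at some slope (the range count is the
landed `card_topSets_le_sharp` argument of `…ValuativeDoorTopSets`, verbatim).  Pure finite combinatorics + real line arithmetic; nothing here is a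
stub of the line or closes anything; no bearing on vW / vB, `TropicalB`, `MatrixDescartes` (18050) or VP ≠ VNP.  [elementary]
-/

set_option linter.dupNamespace false
set_option autoImplicit false

namespace Summit.ValiantsHypothesis.ValiantsHypothesis.Theorems.KPlusLogSqLaw.ValDoor

open Finset
open scoped BigOperators Classical

variable {K : ℕ}

/-! ## §1 Two lines -/

/-- two lines that swap order between `s < s'` have slopes in the same order. [bookkeeping] -/
theorem slope_lt_of_swap {aI aJ EI EJ s s' : ℝ} (h1 : aJ + s * EJ < aI + s * EI) (h2 : aI + s' * EI < aJ + s' * EJ)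
    (hss : s < s') : EI < EJ := by
  by_contra h
  rw [not_lt] at h
  have h3 : s' * EJ - s * EJ ≤ s' * EI - s * EI := by
    have := mul_le_mul_of_nonneg_left h (sub_nonneg.2 hss.le)
    rwa [sub_mul, sub_mul] at this
  linarith

/-- the crossing slope: for `EI < EJ`, line `J` is below line `I` at `t` iff `t ≤ (aI − aJ)/(EJ − EI)`. [bookkeeping] -/
theorem line_le_iff_le_cross {aI aJ EI EJ : ℝ} (hE : EI < EJ) (t : ℝ) :
    aJ + t * EJ ≤ aI + t * EI ↔ t ≤ (aI - aJ) / (EJ - EI) := by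
  rw [le_div_iff₀ (sub_pos.2 hE), mul_sub]
  constructor <;> intro h <;> linarith

/-- strict version of the crossing slope. [bookkeeping] -/
theorem line_lt_iff_lt_cross {aI aJ EI EJ : ℝ} (hE : EI < EJ) (t : ℝ) :
    aJ + t * EJ < aI + t * EI ↔ t < (aI - aJ) / (EJ - EI) := by
  rw [lt_div_iff₀ (sub_pos.2 hE), mul_sub]
  constructor <;> intro h <;> linarith

/-- past a (weak) comparison the line of larger slope pulls strictly ahead. [bookkeeping] -/
theorem line_lt_of_le_of_lt {aT aJ ET EJ s₀ t : ℝ} (h : aT + s₀ * ET ≤ aJ + s₀ * EJ) (hE : ET < EJ) (hst : s₀ < t) :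
    aT + t * ET < aJ + t * EJ := by
  have h3 : 0 < (t - s₀) * (EJ - ET) := mul_pos (sub_pos.2 hst) (sub_pos.2 hE)
  rw [sub_mul, mul_sub, mul_sub] at h3
  linarith

/-- weak version. [bookkeeping] -/
theorem line_le_of_le_of_le {aT aJ ET EJ s₀ t : ℝ} (h : aT + s₀ * ET ≤ aJ + s₀ * EJ) (hE : ET ≤ EJ) (hst : s₀ ≤ t) :
    aT + t * ET ≤ aJ + t * EJ := by
  have h3 : 0 ≤ (t - s₀) * (EJ - ET) := mul_nonneg (sub_nonneg.2 hst) (sub_nonneg.2 hE)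
  rw [sub_mul, mul_sub, mul_sub] at h3
  linarith

/-- **the top tie is unique:** two members of the tie family that both have the largest exponent coincide (each would have strictly larger
rank potential than the other by `rankPotential_lt_of_tieMax`).  This replaces dissociation in everything below. [elementary] -/
theorem tieMax_unique (𝒮 : Finset (Finset (Fin K))) (a : Finset (Fin K) → ℝ) (d : Fin K → ℕ)
    (hd : Function.Injective d) (m : ℕ) (hcard : ∀ S ∈ 𝒮, S.card = m)
    (hX : ∀ A ∈ 𝒮, ∀ B ∈ 𝒮, ∀ i ∈ A \ B, ∃ j ∈ B \ A, insert j (A.erase i) ∈ 𝒮 ∧ insert i (B.erase j) ∈ 𝒮 ∧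
      a A + a B ≤ a (insert j (A.erase i)) + a (insert i (B.erase j)))
    (s M : ℝ) (hmax : ∀ T ∈ 𝒮, a T + s * ((∑ l ∈ T, d l : ℕ) : ℝ) ≤ M)
    {J J' : Finset (Fin K)} (hJ : J ∈ 𝒮) (hJM : a J + s * ((∑ l ∈ J, d l : ℕ) : ℝ) = M)
    (hJtop : ∀ T ∈ 𝒮, a T + s * ((∑ l ∈ T, d l : ℕ) : ℝ) = M → ∑ l ∈ T, d l ≤ ∑ l ∈ J, d l)
    (hJ' : J' ∈ 𝒮) (hJ'M : a J' + s * ((∑ l ∈ J', d l : ℕ) : ℝ) = M)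
    (hJ'top : ∀ T ∈ 𝒮, a T + s * ((∑ l ∈ T, d l : ℕ) : ℝ) = M → ∑ l ∈ T, d l ≤ ∑ l ∈ J', d l) : J = J' := by
  by_contra hne
  have h1 := rankPotential_lt_of_tieMax 𝒮 a d hd m hcard hX s M hmax hJ hJM hJtop hJ' hJ'M (Ne.symm hne)
  have h2 := rankPotential_lt_of_tieMax 𝒮 a d hd m hcard hX s M hmax hJ' hJ'M hJ'top hJ hJM hne
  exact lt_asymm h1 h2

/-! ## §2 The next dominant set -/

/-- **THE BREAKPOINT STEP.**  `I` dominant at `s`, `J ≠ I` dominant at `s' > s`: there is `J₁ ∈ 𝒮` of larger exponent than `I` with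
`Φ(I) < Φ(J₁)`, and either `J₁ = J` or `J₁` is dominant at some slope `t₁ < s'`.  (`J₁` = the top of the tie family at the first slope
`s*` where a larger-exponent line catches `I`; `I` is the bottom of that family; `t₁` = midpoint of `s*` and the next catch of `J₁`; lines of
equal exponent keep a constant gap, so no dissociation is needed.) [elementary] -/
theorem exists_next_dominant (𝒮 : Finset (Finset (Fin K))) (a : Finset (Fin K) → ℝ) (d : Fin K → ℕ)
    (hd : Function.Injective d) (m : ℕ) (hcard : ∀ S ∈ 𝒮, S.card = m)
    (hX : ∀ A ∈ 𝒮, ∀ B ∈ 𝒮, ∀ i ∈ A \ B, ∃ j ∈ B \ A, insert j (A.erase i) ∈ 𝒮 ∧ insert i (B.erase j) ∈ 𝒮 ∧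
      a A + a B ≤ a (insert j (A.erase i)) + a (insert i (B.erase j)))
    {I J : Finset (Fin K)} {s s' : ℝ} (hI : I ∈ 𝒮)
    (hIdom : ∀ T ∈ 𝒮, T ≠ I → a T + s * ((∑ l ∈ T, d l : ℕ) : ℝ) < a I + s * ((∑ l ∈ I, d l : ℕ) : ℝ))
    (hJ : J ∈ 𝒮)
    (hJdom : ∀ T ∈ 𝒮, T ≠ J → a T + s' * ((∑ l ∈ T, d l : ℕ) : ℝ) < a J + s' * ((∑ l ∈ J, d l : ℕ) : ℝ))
    (hss : s < s') (hne : I ≠ J) :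
    ∃ J₁ ∈ 𝒮, ∑ l ∈ I, d l < ∑ l ∈ J₁, d l ∧
      ∑ l ∈ I, (univ.filter fun x => d x < d l).card < ∑ l ∈ J₁, (univ.filter fun x => d x < d l).card ∧
      (J₁ = J ∨ ∃ t₁ : ℝ, t₁ < s' ∧
        ∀ T ∈ 𝒮, T ≠ J₁ → a T + t₁ * ((∑ l ∈ T, d l : ℕ) : ℝ) < a J₁ + t₁ * ((∑ l ∈ J₁, d l : ℕ) : ℝ)) := by
  -- (1) E I < E J
  have hEIJ : ∑ l ∈ I, d l < ∑ l ∈ J, d l := by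
    have h : ((∑ l ∈ I, d l : ℕ) : ℝ) < ((∑ l ∈ J, d l : ℕ) : ℝ) :=
      slope_lt_of_swap (hIdom J hJ hne.symm) (hJdom I hI hne) hss
    exact_mod_cast h
  -- (2) the larger-exponent sets and the first catch s*
  set 𝒯 : Finset (Finset (Fin K)) := 𝒮.filter fun T => ∑ l ∈ I, d l < ∑ l ∈ T, d l with h𝒯
  set c : Finset (Fin K) → ℝ := fun T => (a I - a T) / (((∑ l ∈ T, d l : ℕ) : ℝ) - ((∑ l ∈ I, d l : ℕ) : ℝ)) with hc
  have hJ𝒯 : J ∈ 𝒯 := Finset.mem_filter.2 ⟨hJ, hEIJ⟩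
  have h𝒯ne : (𝒯.image c).Nonempty := ⟨c J, Finset.mem_image_of_mem c hJ𝒯⟩
  set sstar : ℝ := (𝒯.image c).min' h𝒯ne with hsstar
  have hsstar_le : ∀ T ∈ 𝒯, sstar ≤ c T := fun T hT => Finset.min'_le _ _ (Finset.mem_image_of_mem c hT)
  obtain ⟨T₀, hT₀𝒯, hT₀c⟩ : ∃ T₀ ∈ 𝒯, c T₀ = sstar := Finset.mem_image.1 (Finset.min'_mem _ h𝒯ne)
  obtain ⟨hT₀, hT₀E⟩ := Finset.mem_filter.1 hT₀𝒯
  have hT₀E' : ((∑ l ∈ I, d l : ℕ) : ℝ) < ((∑ l ∈ T₀, d l : ℕ) : ℝ) := by exact_mod_cast hT₀E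
  have hT₀ne : T₀ ≠ I := fun h => by rw [h] at hT₀E; exact lt_irrefl _ hT₀E
  -- s < s* < s'
  have hs_lt : s < sstar := by
    rw [← hT₀c]
    exact (line_lt_iff_lt_cross hT₀E' s).1 (hIdom T₀ hT₀ hT₀ne)
  have hEIJ' : ((∑ l ∈ I, d l : ℕ) : ℝ) < ((∑ l ∈ J, d l : ℕ) : ℝ) := by exact_mod_cast hEIJ
  have hcJ : c J < s' := by
    by_contra h
    rw [not_lt] at h
    have := (line_le_iff_le_cross hEIJ' s').2 h
    exact absurd (hJdom I hI hne) (not_lt.2 this)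
  have hsstar_lt : sstar < s' := (hsstar_le J hJ𝒯).trans_lt hcJ
  -- (3) at s* the line of I is on top
  set M : ℝ := a I + sstar * ((∑ l ∈ I, d l : ℕ) : ℝ) with hM
  have hmax : ∀ T ∈ 𝒮, a T + sstar * ((∑ l ∈ T, d l : ℕ) : ℝ) ≤ M := by
    intro T hT
    rcases lt_trichotomy (∑ l ∈ T, d l) (∑ l ∈ I, d l) with hlt | heq | hgt
    · by_cases hTI : T = I
      · rw [hTI]
      · have hlt' : ((∑ l ∈ T, d l : ℕ) : ℝ) < ((∑ l ∈ I, d l : ℕ) : ℝ) := by exact_mod_cast hlt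
        exact (line_lt_of_le_of_lt (hIdom T hT hTI).le hlt' hs_lt).le
    · by_cases hTI : T = I
      · rw [hTI]
      · -- equal exponents: the gap is constant
        have h1 := hIdom T hT hTI
        rw [heq] at h1 ⊢
        linarith
    · have hgt' : ((∑ l ∈ I, d l : ℕ) : ℝ) < ((∑ l ∈ T, d l : ℕ) : ℝ) := by exact_mod_cast hgt
      exact (line_le_iff_le_cross hgt' sstar).2 (hsstar_le T (Finset.mem_filter.2 ⟨hT, hgt⟩))
  have hIM : a I + sstar * ((∑ l ∈ I, d l : ℕ) : ℝ) = M := rfl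
  have hT₀M : a T₀ + sstar * ((∑ l ∈ T₀, d l : ℕ) : ℝ) = M := by
    refine le_antisymm (hmax T₀ hT₀) (not_lt.1 fun hlt => ?_)
    have hlt' : sstar < c T₀ := (line_lt_iff_lt_cross hT₀E' sstar).1 hlt
    rw [hT₀c] at hlt'
    exact lt_irrefl _ hlt'
  -- (4) the top tie J₁
  set Tie : Finset (Finset (Fin K)) := 𝒮.filter fun T => a T + sstar * ((∑ l ∈ T, d l : ℕ) : ℝ) = M with hTie
  have hITie : I ∈ Tie := Finset.mem_filter.2 ⟨hI, hIM⟩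
  obtain ⟨J₁, hJ₁Tie, hJ₁max⟩ := Finset.exists_max_image Tie (fun T => ∑ l ∈ T, d l) ⟨I, hITie⟩
  obtain ⟨hJ₁, hJ₁M⟩ := Finset.mem_filter.1 hJ₁Tie
  have hJtop : ∀ T ∈ 𝒮, a T + sstar * ((∑ l ∈ T, d l : ℕ) : ℝ) = M → ∑ l ∈ T, d l ≤ ∑ l ∈ J₁, d l :=
    fun T hT hTM => hJ₁max T (Finset.mem_filter.2 ⟨hT, hTM⟩)
  have hEIJ₁ : ∑ l ∈ I, d l < ∑ l ∈ J₁, d l := hT₀E.trans_le (hJtop T₀ hT₀ hT₀M)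
  have hIJ₁ : I ≠ J₁ := fun h => by rw [← h] at hEIJ₁; exact lt_irrefl _ hEIJ₁
  have hΦ := rankPotential_lt_of_tieMax 𝒮 a d hd m hcard hX sstar M hmax hJ₁ hJ₁M hJtop hI hIM hIJ₁
  refine ⟨J₁, hJ₁, hEIJ₁, hΦ, ?_⟩
  by_cases hJ₁J : J₁ = J
  · exact Or.inl hJ₁J
  right
  -- (5) J₁ is dominant just after s*
  have hEJ₁J : ∑ l ∈ J₁, d l < ∑ l ∈ J, d l := by
    by_contra h
    rw [not_lt] at h
    have h' : ((∑ l ∈ J, d l : ℕ) : ℝ) ≤ ((∑ l ∈ J₁, d l : ℕ) : ℝ) := by exact_mod_cast h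
    have h1 : a J + sstar * ((∑ l ∈ J, d l : ℕ) : ℝ) ≤ a J₁ + sstar * ((∑ l ∈ J₁, d l : ℕ) : ℝ) := by
      rw [hJ₁M]; exact hmax J hJ
    exact absurd (hJdom J₁ hJ₁ hJ₁J) (not_lt.2 (line_le_of_le_of_le h1 h' hsstar_lt.le))
  set 𝒰 : Finset (Finset (Fin K)) := 𝒮.filter fun T => ∑ l ∈ J₁, d l < ∑ l ∈ T, d l with h𝒰
  set c₁ : Finset (Fin K) → ℝ := fun T => (a J₁ - a T) / (((∑ l ∈ T, d l : ℕ) : ℝ) - ((∑ l ∈ J₁, d l : ℕ) : ℝ)) with hc₁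
  have hJ𝒰 : J ∈ 𝒰 := Finset.mem_filter.2 ⟨hJ, hEJ₁J⟩
  have h𝒰ne : (𝒰.image c₁).Nonempty := ⟨c₁ J, Finset.mem_image_of_mem c₁ hJ𝒰⟩
  set tplus : ℝ := (𝒰.image c₁).min' h𝒰ne with htplus
  have htplus_le : ∀ T ∈ 𝒰, tplus ≤ c₁ T := fun T hT => Finset.min'_le _ _ (Finset.mem_image_of_mem c₁ hT)
  obtain ⟨T₁, hT₁𝒰, hT₁c⟩ : ∃ T₁ ∈ 𝒰, c₁ T₁ = tplus := Finset.mem_image.1 (Finset.min'_mem _ h𝒰ne)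
  obtain ⟨hT₁, hT₁E⟩ := Finset.mem_filter.1 hT₁𝒰
  have hT₁E' : ((∑ l ∈ J₁, d l : ℕ) : ℝ) < ((∑ l ∈ T₁, d l : ℕ) : ℝ) := by exact_mod_cast hT₁E
  -- s* < t⁺ ≤ c₁ J < s'
  have hsstar_tplus : sstar < tplus := by
    rw [← hT₁c]
    refine (line_lt_iff_lt_cross hT₁E' sstar).1 (lt_of_le_of_ne (hJ₁M.symm ▸ hmax T₁ hT₁) fun hT₁M => ?_)
    have := hJtop T₁ hT₁ (hT₁M.trans hJ₁M)
    exact absurd hT₁E (not_lt.2 this)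
  have hEJ₁J' : ((∑ l ∈ J₁, d l : ℕ) : ℝ) < ((∑ l ∈ J, d l : ℕ) : ℝ) := by exact_mod_cast hEJ₁J
  have hc₁J : c₁ J < s' := by
    by_contra h
    rw [not_lt] at h
    have := (line_le_iff_le_cross hEJ₁J' s').2 h
    exact absurd (hJdom J₁ hJ₁ hJ₁J) (not_lt.2 this)
  have htplus_lt : tplus < s' := (htplus_le J hJ𝒰).trans_lt hc₁J
  refine ⟨(sstar + tplus) / 2, by linarith, fun T hT hTJ₁ => ?_⟩
  rcases lt_trichotomy (∑ l ∈ T, d l) (∑ l ∈ J₁, d l) with hlt | heq | hgt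
  · have hlt' : ((∑ l ∈ T, d l : ℕ) : ℝ) < ((∑ l ∈ J₁, d l : ℕ) : ℝ) := by exact_mod_cast hlt
    exact line_lt_of_le_of_lt (hJ₁M.symm ▸ hmax T hT) hlt' (by linarith)
  · -- equal exponents: T is not a tie (the top tie is unique), so its constant gap to J₁ is negative
    have hTM : a T + sstar * ((∑ l ∈ T, d l : ℕ) : ℝ) < M := by
      refine lt_of_le_of_ne (hmax T hT) fun hTM => hTJ₁ ?_
      refine (tieMax_unique 𝒮 a d hd m hcard hX sstar M hmax hJ₁ hJ₁M hJtop hT hTM fun T' hT' hT'M => ?_).symm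
      rw [heq]
      exact hJtop T' hT' hT'M
    rw [← hJ₁M, heq] at hTM
    rw [heq]
    linarith
  · have hgt' : ((∑ l ∈ J₁, d l : ℕ) : ℝ) < ((∑ l ∈ T, d l : ℕ) : ℝ) := by exact_mod_cast hgt
    refine (line_lt_iff_lt_cross hgt' _).2 ?_
    have := htplus_le T (Finset.mem_filter.2 ⟨hT, hgt⟩)
    linarith

/-! ## §3 The rank potential increases along the chain of dominant sets -/

/-- **THE RANK POTENTIAL STRICTLY INCREASES WITH THE SLOPE OF DOMINANCE:** `I` dominant at `s`, `J ≠ I` dominant at `s' > s` ⇒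
`Φ(I) < Φ(J)`.  Induction on the number of sets of exponent above `E(I)`, through `exists_next_dominant`. [elementary] -/
theorem rankPotential_lt_of_dominant (𝒮 : Finset (Finset (Fin K))) (a : Finset (Fin K) → ℝ) (d : Fin K → ℕ)
    (hd : Function.Injective d) (m : ℕ) (hcard : ∀ S ∈ 𝒮, S.card = m)
    (hX : ∀ A ∈ 𝒮, ∀ B ∈ 𝒮, ∀ i ∈ A \ B, ∃ j ∈ B \ A, insert j (A.erase i) ∈ 𝒮 ∧ insert i (B.erase j) ∈ 𝒮 ∧
      a A + a B ≤ a (insert j (A.erase i)) + a (insert i (B.erase j))) :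
    ∀ (n : ℕ) (I J : Finset (Fin K)) (s s' : ℝ), (𝒮.filter fun T => ∑ l ∈ I, d l < ∑ l ∈ T, d l).card ≤ n →
      I ∈ 𝒮 → (∀ T ∈ 𝒮, T ≠ I → a T + s * ((∑ l ∈ T, d l : ℕ) : ℝ) < a I + s * ((∑ l ∈ I, d l : ℕ) : ℝ)) →
      J ∈ 𝒮 → (∀ T ∈ 𝒮, T ≠ J → a T + s' * ((∑ l ∈ T, d l : ℕ) : ℝ) < a J + s' * ((∑ l ∈ J, d l : ℕ) : ℝ)) →
      s < s' → I ≠ J →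
      ∑ l ∈ I, (univ.filter fun x => d x < d l).card < ∑ l ∈ J, (univ.filter fun x => d x < d l).card := by
  intro n
  induction n with
  | zero =>
    intro I J s s' hn hI hIdom hJ hJdom hss hne
    obtain ⟨J₁, hJ₁, hEJ₁, -, -⟩ := exists_next_dominant 𝒮 a d hd m hcard hX hI hIdom hJ hJdom hss hne
    have : J₁ ∈ 𝒮.filter fun T => ∑ l ∈ I, d l < ∑ l ∈ T, d l := Finset.mem_filter.2 ⟨hJ₁, hEJ₁⟩
    have hpos := Finset.card_pos.2 ⟨J₁, this⟩
    omega
  | succ n ih =>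
    intro I J s s' hn hI hIdom hJ hJdom hss hne
    obtain ⟨J₁, hJ₁, hEJ₁, hΦ, hor⟩ := exists_next_dominant 𝒮 a d hd m hcard hX hI hIdom hJ hJdom hss hne
    rcases hor with rfl | ⟨t₁, ht₁, hJ₁dom⟩
    · exact hΦ
    · by_cases hJ₁J : J₁ = J
      · rw [hJ₁J] at hΦ; exact hΦ
      · have hμ : (𝒮.filter fun T => ∑ l ∈ J₁, d l < ∑ l ∈ T, d l).card ≤ n := by
          have hss' : (𝒮.filter fun T => ∑ l ∈ J₁, d l < ∑ l ∈ T, d l) ⊂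
              (𝒮.filter fun T => ∑ l ∈ I, d l < ∑ l ∈ T, d l) := by
            rw [Finset.ssubset_iff_subset_ne]
            refine ⟨fun T hT => ?_, fun heq => ?_⟩
            · obtain ⟨hT𝒮, hTE⟩ := Finset.mem_filter.1 hT
              exact Finset.mem_filter.2 ⟨hT𝒮, hEJ₁.trans hTE⟩
            · have : J₁ ∈ 𝒮.filter fun T => ∑ l ∈ J₁, d l < ∑ l ∈ T, d l :=
                heq.symm ▸ Finset.mem_filter.2 ⟨hJ₁, hEJ₁⟩
              exact lt_irrefl _ (Finset.mem_filter.1 this).2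
          have := Finset.card_lt_card hss'
          omega
        exact hΦ.trans (ih J₁ J t₁ s' hμ hJ₁ hJ₁dom hJ hJdom ht₁ hJ₁J)

/-! ## §4 The count -/

/-- **AT MOST `m (K − m) + 1` DOMINANT SETS.**  In an exchange system of `m`-sets with distinct slopes (no dissociation), a family of
sets each dominant at some slope has at most `m · (K − m) + 1` members: the rank potential is injective on it
(`rankPotential_lt_of_dominant`) and is a sum of `m` distinct ranks in `[0, K − 1]` (range count verbatim from the landed
`card_topSets_le_sharp`). [elementary] -/
theorem card_dominant_le (𝒮 : Finset (Finset (Fin K))) (a : Finset (Fin K) → ℝ) (d : Fin K → ℕ)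
    (hd : Function.Injective d) (m : ℕ) (hcard : ∀ S ∈ 𝒮, S.card = m)
    (hX : ∀ A ∈ 𝒮, ∀ B ∈ 𝒮, ∀ i ∈ A \ B, ∃ j ∈ B \ A, insert j (A.erase i) ∈ 𝒮 ∧ insert i (B.erase j) ∈ 𝒮 ∧
      a A + a B ≤ a (insert j (A.erase i)) + a (insert i (B.erase j)))
    (𝒟 : Finset (Finset (Fin K)))
    (h𝒟 : ∀ S ∈ 𝒟, S ∈ 𝒮 ∧ ∃ s : ℝ, ∀ T ∈ 𝒮, T ≠ S → a T + s * ((∑ l ∈ T, d l : ℕ) : ℝ) < a S + s * ((∑ l ∈ S, d l : ℕ) : ℝ)) :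
    𝒟.card ≤ m * (K - m) + 1 := by
  set rk : Fin K → ℕ := fun l => (univ.filter fun x => d x < d l).card with hrk
  set Φ : Finset (Fin K) → ℕ := fun T => ∑ l ∈ T, rk l with hΦ
  have hrk_inj : Function.Injective rk := rank_injective d hd
  -- Φ is injective on 𝒟
  have hinj : Set.InjOn Φ (𝒟 : Set (Finset (Fin K))) := by
    intro S hS S' hS' hΦeq
    by_contra hne
    obtain ⟨hS𝒮, s, hs⟩ := h𝒟 S (Finset.mem_coe.1 hS)
    obtain ⟨hS'𝒮, s', hs'⟩ := h𝒟 S' (Finset.mem_coe.1 hS')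
    rcases lt_trichotomy s s' with hlt | heq | hgt
    · exact absurd hΦeq (ne_of_lt (rankPotential_lt_of_dominant 𝒮 a d hd m hcard hX _ S S' s s' le_rfl
        hS𝒮 hs hS'𝒮 hs' hlt hne))
    · subst heq
      exact lt_asymm (hs S' hS'𝒮 (Ne.symm hne)) (hs' S hS𝒮 hne)
    · exact absurd hΦeq.symm (ne_of_lt (rankPotential_lt_of_dominant 𝒮 a d hd m hcard hX _ S' S s' s le_rfl
        hS'𝒮 hs' hS𝒮 hs hgt (Ne.symm hne)))
  have hcard𝒟 : ∀ T ∈ 𝒟, T.card = m := fun T hT => hcard T (h𝒟 T hT).1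
  set L : ℕ := ∑ i ∈ range m, i with hL
  -- lower bound: a sum of m distinct naturals
  have hlow : ∀ T ∈ 𝒟, L ≤ Φ T := by
    intro T hT
    have h1 : (T.image rk).card = m := by rw [Finset.card_image_of_injective _ hrk_inj, hcard𝒟 T hT]
    have h2 := sum_range_le_sum_of_card m (T.image rk) h1
    rw [Finset.sum_image fun x _ y _ h => hrk_inj h] at h2
    exact h2
  -- upper bound: the co-ranks `K − 1 − rk` are distinct too
  have hupp : ∀ T ∈ 𝒟, Φ T + L ≤ m * (K - 1) := by
    intro T hT
    set crk : Fin K → ℕ := fun l => (K - 1) - rk l with hcrk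
    have hcrk_inj : Function.Injective crk := by
      intro l l' h
      have h1 := rank_le d l
      have h2 := rank_le d l'
      apply hrk_inj
      change (K - 1) - rk l = (K - 1) - rk l' at h
      change rk l ≤ K - 1 at h1
      change rk l' ≤ K - 1 at h2
      omega
    have h1 : (T.image crk).card = m := by rw [Finset.card_image_of_injective _ hcrk_inj, hcard𝒟 T hT]
    have h2 := sum_range_le_sum_of_card m (T.image crk) h1
    rw [Finset.sum_image fun x _ y _ h => hcrk_inj h] at h2
    have h3 : ∑ l ∈ T, crk l + Φ T = m * (K - 1) := by
      change ∑ l ∈ T, crk l + ∑ l ∈ T, rk l = m * (K - 1)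
      rw [← Finset.sum_add_distrib, Finset.sum_congr rfl fun l _ => (Nat.sub_add_cancel (rank_le d l) : crk l + rk l = K - 1),
        Finset.sum_const, smul_eq_mul, hcard𝒟 T hT]
    omega
  have hrange : ∀ T ∈ 𝒟, Φ T ∈ Finset.Icc L (m * (K - 1) - L) := by
    intro T hT
    rw [Finset.mem_Icc]
    have h1 := hlow T hT
    have h2 := hupp T hT
    omega
  have hL2 : L * 2 = m * (m - 1) := Finset.sum_range_id_mul_two m
  have hfin : m * (K - 1) - L + 1 - L ≤ m * (K - m) + 1 := by
    rcases Nat.eq_zero_or_pos m with hm0 | hmpos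
    · subst hm0; simp [hL]
    · by_cases hKm : m ≤ K
      · have hsplit : K - 1 = (K - m) + (m - 1) := by omega
        have hP : m * (K - 1) = m * (K - m) + m * (m - 1) := by rw [hsplit, mul_add]
        omega
      · push Not at hKm
        have h0 : K - m = 0 := by omega
        have hle : m * (K - 1) ≤ m * (m - 1) := Nat.mul_le_mul_left m (by omega)
        rw [h0, mul_zero]
        omega
  calc 𝒟.card ≤ (Finset.Icc L (m * (K - 1) - L)).card := Finset.card_le_card_of_injOn Φ hrange hinj
    _ = m * (K - 1) - L + 1 - L := Nat.card_Icc _ _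
    _ ≤ m * (K - m) + 1 := hfin

end Summit.ValiantsHypothesis.ValiantsHypothesis.Theorems.KPlusLogSqLaw.ValDoor
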